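import Summits.NavierStokesRegularity.NavierStokesRegularity.Theorems.StrainDoorsPeakHeightFloor
import HarnessLib

/-!
# StrainDoorsPeakDoorsLargeConstant — the LARGE-CONSTANT halves of PART K's doors K-α, K-β, K-γ are theorems

LEAD plate of the S-door lane (ns-s30-p1 g6; helper lane of `stmt-NavierStokesRegularity-0056`, rung N0;
`--supports stmt-NavierStokesRegularity-0056 --as helper`).  No new definitions; no sorry.

PART K (ROUND 60, `StrainDoorsPeakDoors`) splits the programme's hard core on the Type-I tangent peak class into a
GEOMETRIC floor (K-α `PeakConcavityFloor C₀ κ`: `κ ≤ (−Δ|ω̄|)(z̄)/ρ̄`, or K-β `PeakTwistFloor C₀ κ`: `κ ≤ |∇ξ̄|²_F`) and a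
DYNAMIC cap (K-γ `PeakStretchingCap C₀ κ`: `(0+1)ᾱ < 1 + (0+1)κ`), the two with the SAME `κ` emptying the class.  PART J's
Laplacian bound `|Δω̄(−1,·)| ≤ K₃(C₀)` and the record identity give `(0+1)ᾱ − 1 ≤ K₃/ρ̄`, `|∇ξ̄|²_F ≤ K₃/ρ̄`,
`(−Δ|ω̄|)(z̄)/ρ̄ ≤ K₃/ρ̄` (`peak_height_le_of_twistFloor`'s mechanism); with the PEAK HEIGHT FLOOR `ρ̄ > η(C₀)`
(`peak_height_floor`, from the small-vorticity-number Liouville theorem) all three peak quantities are UNIFORMLY BOUNDED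
on the class by `B(C₀) = K₃/η + 1`:

* ★★ `peak_geometry_lt` — `∃ B(C₀)`: every peak has `(0+1)ᾱ − 1 < B`, `|∇ξ̄|²_F < B` and `(−Δ|ω̄|)(z̄)/ρ̄ < B`;
* ★★ `peakStretchingCap_of_large` — DOOR K-γ HOLDS for every `κ ≥ B(C₀)`: the stretching cap is FREE in the large regime;
* ★★ `peakClassEmpty_of_large_concavityFloor`, `eq_zero_of_typeI_of_large_concavityFloor` — DOOR K-α with `κ ≥ B(C₀)`
  empties the class BY ITSELF (PART K's `peakClassEmpty_of_concavityFloor_of_cap` with the free cap), hence the Type-I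
  Liouville theorem for classical solutions; the K-β analogue is `peakClassEmpty_of_large_twistFloor`
  (`StrainDoorsPeakHeightFloor`).
So only the SMALL-CONSTANT regime `κ < B(C₀)` of the three doors is open — which is where `0056` lives.

WHAT THIS IS NOT: door bookkeeping for a HYPOTHETICAL Type-I blow-up profile with ineffective constants (`K₃`, `η`, `B`);
nothing excludes a blow-up; `0056` / `10661` / NS regularity are NOT proved.
[cite: KochNadirashviliSereginSverak2009, §4 (arXiv:0709.3599); GigaMiura2011, §2]
-/

noncomputable section

open MeasureTheory Set Function Filter Metric Real InnerProductSpace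
open _root_.Topology
open scoped ENNReal NNReal RealInnerProductSpace ContDiff Laplacian
open Literature.Analysis Literature.Analysis.FluidPDE
open Literature.Analysis.FluidPDE.VorticityDirectionDynamics

set_option linter.dupNamespace false

namespace Summit.NavierStokesRegularity.NavierStokesRegularity.Theorems.StrainDoors

open Summit.NavierStokesRegularity.NavierStokesRegularity.Theorems.ArgmaxDoors

/-- ★★ **UNIFORM BOUNDS ON THE PEAK GEOMETRY.**  For every `C₀` there is `B = B(C₀) ≥ 0` such that every Type-I tangent
peak `(v, z̄)` with constant `C₀` satisfies, at `(−1, z̄)` with `ρ̄ = |ω̄(z̄)|`, `ξ̄ = ω̄/ρ̄`, `ᾱ = ⟪ξ̄, ∇v̄ ξ̄⟫`: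
`(0+1)ᾱ − 1 < B`, `|∇ξ̄|²_F < B`, `(−Δ|ω̄|)(z̄)/ρ̄ < B` (record identity + `|Δω̄| ≤ K₃(C₀)` + the floor `ρ̄ > η(C₀)`;
`B = K₃/η + 1`). [tree composition] -/
theorem peak_geometry_lt (C₀ : ℝ) :
    ∃ B : ℝ, 0 ≤ B ∧ ∀ (v : ℝ → EuclideanSpace ℝ (Fin 3) → EuclideanSpace ℝ (Fin 3)) (zbar : EuclideanSpace ℝ (Fin 3)),
      IsTypeITangentPeak C₀ v zbar →
        (0 - (-1)) * ⟪vorticityDirection (curl (v (-1))) zbar,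
            fderiv ℝ (v (-1)) zbar (vorticityDirection (curl (v (-1))) zbar)⟫ - 1 < B ∧
        frobeniusNormSq (fderiv ℝ (vorticityDirection (curl (v (-1)))) zbar) < B ∧
        (-(Δ fun y => ‖curl (v (-1)) y‖) zbar) / ‖curl (v (-1)) zbar‖ < B := by
  obtain ⟨K₃, hK₃, hb⟩ := tangent_laplacian_curl_bound C₀
  obtain ⟨η, hη, hfloor⟩ := peak_height_floor C₀
  refine ⟨K₃ / η + 1, by positivity, fun v zbar h => ?_⟩
  obtain ⟨-, -, -, hid, hid', hii⟩ := h.record_identity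
  have hne := h.2.2.2.1
  have hρη : η < ‖curl (v (-1)) zbar‖ := hfloor v zbar h
  have hρ : 0 < ‖curl (v (-1)) zbar‖ := hη.trans hρη
  have hM : ‖(Δ (curl (v (-1)))) zbar‖ ≤ K₃ := hb h.1 h.2.1 h.2.2.1 (-1) (by norm_num) zbar
  have hξ : ‖vorticityDirection (curl (v (-1))) zbar‖ = 1 := norm_vorticityDirection _ hne
  have hGM : -⟪vorticityDirection (curl (v (-1))) zbar, (Δ (curl (v (-1)))) zbar⟫ ≤ K₃ := by
    have h1 := abs_real_inner_le_norm (vorticityDirection (curl (v (-1))) zbar) ((Δ (curl (v (-1)))) zbar)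
    rw [hξ, one_mul] at h1
    linarith [neg_abs_le ⟪vorticityDirection (curl (v (-1))) zbar, (Δ (curl (v (-1)))) zbar⟫]
  -- `K₃/ρ̄ < K₃/η + 1`
  have hq : K₃ / ‖curl (v (-1)) zbar‖ < K₃ / η + 1 := by
    have : K₃ / ‖curl (v (-1)) zbar‖ ≤ K₃ / η := div_le_div_of_nonneg_left hK₃ hη hρη.le
    linarith
  -- the stretching excess `(0+1)ᾱ − 1 = (−⟪ξ̄,Δω̄⟫)/ρ̄ ≤ K₃/ρ̄`
  have hS : (0 - (-1)) * ⟪vorticityDirection (curl (v (-1))) zbar,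
      fderiv ℝ (v (-1)) zbar (vorticityDirection (curl (v (-1))) zbar)⟫ - 1 ≤ K₃ / ‖curl (v (-1)) zbar‖ := by
    have e : (0 - (-1 : ℝ)) * (-⟪vorticityDirection (curl (v (-1))) zbar, (Δ (curl (v (-1)))) zbar⟫) /
        ‖curl (v (-1)) zbar‖ = (-⟪vorticityDirection (curl (v (-1))) zbar, (Δ (curl (v (-1)))) zbar⟫) /
        ‖curl (v (-1)) zbar‖ := by ring
    rw [hid', e, add_sub_cancel_left]
    exact div_le_div_of_nonneg_right hGM hρ.le
  -- the twist `|∇ξ̄|²_F ≤ (−⟪ξ̄,Δω̄⟫)/ρ̄ ≤ K₃/ρ̄`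
  have hF : frobeniusNormSq (fderiv ℝ (vorticityDirection (curl (v (-1)))) zbar) ≤ K₃ / ‖curl (v (-1)) zbar‖ := by
    rw [le_div_iff₀ hρ, mul_comm]
    exact hii.trans hGM
  -- the concavity `(−Δ|ω̄|)/ρ̄ = ((0+1)(ᾱ − F) − 1)/(0+1) ≤ (0+1)ᾱ − 1 ≤ K₃/ρ̄`
  have hL : (-(Δ fun y => ‖curl (v (-1)) y‖) zbar) / ‖curl (v (-1)) zbar‖ ≤ K₃ / ‖curl (v (-1)) zbar‖ := by
    have hFnn := frobeniusNormSq_nonneg (fderiv ℝ (vorticityDirection (curl (v (-1)))) zbar)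
    have e : (0 - (-1 : ℝ)) * (-(Δ fun y => ‖curl (v (-1)) y‖) zbar) / ‖curl (v (-1)) zbar‖ =
        (-(Δ fun y => ‖curl (v (-1)) y‖) zbar) / ‖curl (v (-1)) zbar‖ := by ring
    nlinarith [hid, hS, e, hFnn]
  exact ⟨lt_of_le_of_lt hS hq, lt_of_le_of_lt hF hq, lt_of_le_of_lt hL hq⟩

/-- ★★ **DOOR K-γ IS FREE IN THE LARGE REGIME**: with `B(C₀)` of `peak_geometry_lt`, `PeakStretchingCap C₀ κ` HOLDS for
every `κ ≥ B` (the peak stretching rate is a priori `< 1 + (0+1)B`). [tree composition] -/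
theorem peakStretchingCap_of_large (C₀ : ℝ) :
    ∃ B : ℝ, 0 ≤ B ∧ ∀ (κ : ℝ), B ≤ κ → PeakStretchingCap C₀ κ := by
  obtain ⟨B, hB, hgeo⟩ := peak_geometry_lt C₀
  refine ⟨B, hB, fun κ hκ v zbar h => ?_⟩
  have h1 := (hgeo v zbar h).1
  linarith

/-- ★★ **DOOR K-α WITH A LARGE CONSTANT EMPTIES THE CLASS BY ITSELF**: with `B(C₀)` of `peak_geometry_lt`,
`PeakConcavityFloor C₀ κ → PeakClassEmpty C₀` for every `κ ≥ B` (PART K's `peakClassEmpty_of_concavityFloor_of_cap` with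
the free cap `peakStretchingCap_of_large`; equivalently: no peak has concavity `≥ B`). [tree composition] -/
theorem peakClassEmpty_of_large_concavityFloor (C₀ : ℝ) :
    ∃ B : ℝ, 0 ≤ B ∧ ∀ (κ : ℝ), B ≤ κ → PeakConcavityFloor C₀ κ → PeakClassEmpty C₀ := by
  obtain ⟨B, hB, hcap⟩ := peakStretchingCap_of_large C₀
  exact ⟨B, hB, fun κ hκ hfl => peakClassEmpty_of_concavityFloor_of_cap hfl (hcap κ hκ)⟩

/-- ★★ **LARGE CONCAVITY FLOOR ⇒ TYPE-I LIOUVILLE**: with `B(C₀)` as above, door K-α with any `κ ≥ B` forces every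
classical Type-I solution with constant `C₀` on `(−∞,0)` to vanish identically (PART K's consumer). [tree composition] -/
theorem eq_zero_of_typeI_of_large_concavityFloor (C₀ : ℝ) :
    ∃ B : ℝ, 0 ≤ B ∧ ∀ (κ : ℝ), B ≤ κ → PeakConcavityFloor C₀ κ →
      ∀ (u : ℝ → EuclideanSpace ℝ (Fin 3) → EuclideanSpace ℝ (Fin 3)) (p : ℝ → EuclideanSpace ℝ (Fin 3) → ℝ),
        IsClassicalNSSolutionOn (Iio 0) 1 0 u p → HasTypeIDecay C₀ u →
        ∀ t : ℝ, t < 0 → ∀ x : EuclideanSpace ℝ (Fin 3), u t x = 0 := by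
  obtain ⟨B, hB, hE⟩ := peakClassEmpty_of_large_concavityFloor C₀
  exact ⟨B, hB, fun κ hκ hfl u p hsol hI => eq_zero_of_typeI_of_peakClassEmpty (hE κ hκ hfl) hsol hI⟩

/-- ★★ **THE TWIST DOOR IS VACUOUS-OR-CLOSING IN THE LARGE REGIME** (restated with the common bound): with `B(C₀)` of
`peak_geometry_lt`, `PeakTwistFloor C₀ κ` with `κ ≥ B` empties the class (no peak has twist `≥ B`). [tree composition] -/
theorem peakClassEmpty_of_twistFloor_ge (C₀ : ℝ) :
    ∃ B : ℝ, 0 ≤ B ∧ ∀ (κ : ℝ), B ≤ κ → PeakTwistFloor C₀ κ → PeakClassEmpty C₀ := by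
  obtain ⟨B, hB, hgeo⟩ := peak_geometry_lt C₀
  refine ⟨B, hB, fun κ hκ hfl v zbar h => ?_⟩
  have h1 := (hgeo v zbar h).2.1
  have h2 := hfl v zbar h
  linarith

end Summit.NavierStokesRegularity.NavierStokesRegularity.Theorems.StrainDoors

end
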